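import Summits.AtomisticToContinuum.HydrodynamicLimit.Theorems.RelayRaceLocalityLightConeInLawSketchLine

/-!
# (HL-gen) dominates the route: it also gives `NearConstantShortTimeHL`
(crux `LightConeInLaw`, stmt-AtomisticToContinuum-12500, line `Sketch`, `--supports`; route
`RelayRaceLocality`, sub-problem `HydrodynamicLimit`; lead c1, diagnosis bookkeeping)

The single macroscopic hypothesis (HL-gen) under which the core of the crux `LightConeInLaw` is
proved (`DoD.stub_core_of_hydroLimitGeneral`, file `RelayRaceLocalityLightConeInLawCone.lean`) —
the packing-guarded hydrodynamic limit for GENERAL comparison families `(ε N, n N)`,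
`n N · (ε N)³ → σ³`, `ε N → 0` — trivially implies the route's third crux
`RelayRaceLocality.NearConstantShortTimeHL` (stmt-AtomisticToContinuum-12502) as well: that item is
(HL-gen) restricted to near-constant data, short times and more guards. So (HL-gen) alone carries
two of the route's three cruxes; recorded for the planner (the route's decomposition through the
light cone does not lower the difficulty below (HL-gen) by any mechanism typed so far).

* `nearConstantShortTimeHL_of_hydroLimitGeneral` : (HL-gen) → `NearConstantShortTimeHL`.
-/

namespace Summit.AtomisticToContinuum.HydrodynamicLimit.Theorems.LightConeInLawSketch.Dominance

open scoped BigOperators Topology Classical ENNReal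
open Filter Set MeasureTheory
open Literature.MathematicalPhysics.KineticTheory Literature.Analysis.FluidPDE

noncomputable section

/-- **(HL-gen) ⇒ `NearConstantShortTimeHL`.** The packing-guarded hydrodynamic limit for general
comparison families implies the route's near-constant short-time hydrodynamic limit (same
families, same `t = 0` law of large numbers, conclusion asked only for near-constant data, for
`t < min T τ₀` and under additional guards): take `δ₀ := 1`, `τ₀ := 1`, the same `η₀` and `σ₀`,
and discard the extra hypotheses. -/
theorem nearConstantShortTimeHL_of_hydroLimitGeneral :
    (∃ η₁ : ℝ, 0 < η₁ ∧
      ∀ (a θ : T3 → ℝ) (u : T3 → V3), Continuous a → Continuous θ → Continuous u →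
        (∀ x, 0 < a x) → (∀ x, 0 < θ x) →
      ∃ σ₀ : ℝ, 0 < σ₀ ∧ ∀ σ : ℝ, 0 < σ → σ < σ₀ →
      ∀ (ε : ℕ → ℝ) (n : ℕ → ℕ), (∀ N, 0 < ε N) → Tendsto ε atTop (𝓝 0) →
        Tendsto (fun N => (n N : ℝ) * ε N ^ 3) atTop (𝓝 (σ ^ 3)) →
      ∀ (T : ℝ) (ρ Θ : ℝ → T3 → ℝ) (U : ℝ → T3 → V3), IsHardSphereEulerSolution σ T ρ U Θ →
      ∀ Φ : (N : ℕ) → HardSphereFlow G3 (ε N) (n N),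
      (∀ N, IsProbabilityMeasure
        (particleLaw (Φ N) (canonicalDensity G3 (ε N) (n N) (localGibbsProfile a u θ)))) →
      LLNAt n (fun N => particleLaw (Φ N)
        (canonicalDensity G3 (ε N) (n N) (localGibbsProfile a u θ))) Φ (ρ 0) (U 0) (Θ 0) 0 →
      ∀ t : ℝ, 0 ≤ t → t < T → (∀ s ∈ Set.Icc 0 t, ∀ x, ρ s x * σ ^ 3 < η₁) →
      LLNAt n (fun N => particleLaw (Φ N)
        (canonicalDensity G3 (ε N) (n N) (localGibbsProfile a u θ))) Φ (ρ t) (U t) (Θ t) t) →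
    Summit.AtomisticToContinuum.HydrodynamicLimit.Theses.RelayRaceLocality.NearConstantShortTimeHL := by
  rintro ⟨η₁, hη₁, H⟩
  refine ⟨η₁, hη₁, fun M _ => ⟨1, one_pos, 1, one_pos, ?_⟩⟩
  intro a₀ θ₀ u₀ ha hθ hu ha0 hθ0
  obtain ⟨σ₀, hσ₀, Hσ⟩ := H a₀ θ₀ u₀ ha hθ hu ha0 hθ0
  refine ⟨σ₀, hσ₀, ?_⟩
  intro σ hσ hσlt ε n hε hε0 hn T ρ θ u hsol _ Φ P hP hL0 t ht hguard
  exact Hσ σ hσ hσlt ε n hε hε0 hn T ρ θ u hsol Φ hP hL0 t ht.1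
    (ht.2.trans_le (min_le_left _ _)) fun s hs x => (hguard s hs x).1

end

end Summit.AtomisticToContinuum.HydrodynamicLimit.Theorems.LightConeInLawSketch.Dominance
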